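import Summits.FinalStateConjecture.FinalStateConjecture.Theses.SwallowTheDatum
import Literature.Geometry.Lorentzian.KerrDataProofs
import Literature.Geometry.Lorentzian.KerrSchildCoord

/-!
# Route SwallowTheDatum · `TargetGlue` (item stmt-FinalStateConjecture-10186) and the reduction of
# the target `UniversalWitnessFamily` (stmt-FinalStateConjecture-10051) to the route's cruxes

Pure logic. `TargetGlue` reads
`ParametricKerrBurial → KerrShieldedSettles → (MGHD existence for admissible data) →
UniversalWitnessFamily`: the burial supplies, through every admissible datum `d`, a jointly smooth
injective admissible family `F` with `F 0 = d` all of whose members `F c`, `c ≠ 0`, are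
Kerr-shielded; MGHD existence gives the `∃`-MGHD conjunct of the summit's conclusion `P (F c)`,
and `KerrShieldedSettles` gives its `∀`-MGHD conjunct for Kerr-shielded admissible data. The
two crux statements are guarded by the instance binder `∀ [Kerr.Facts]`; the instance is built
here from the three discharged facts `Kerr.isConnected_region_holds` (`KerrDataProofs`),
`Kerr.contMDiff_bilin_holds`, `Kerr.contMDiff_timeVector_holds` (`KerrSchildCoord`), so no
hypothesis beyond the three displayed ones enters.
-/

namespace Summit.FinalStateConjecture.FinalStateConjecture.Theses.SwallowTheDatum

open scoped BigOperators Topology Manifold Classical MeasureTheory ProbabilityTheory Matrix InnerProductSpace ComplexConjugate ContinuousMap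
open Filter Set Function TopologicalSpace MeasureTheory

/-- **Record of the dropped route item `TargetGlue`** = stmt-FinalStateConjecture-10186 (ledger
signature verbatim, in the route file's namespace and `open` context; NOT a route item): the route
dropped this bookkeeping item at rev 4 (2026-08-15T22:46:30Z; its `_holds` link would have cycled)
after `Theorems.SwallowTheDatum.targetGlue_proof` below closed it `proved` at 40f566bd30b9, so the
gate-written `Theses/SwallowTheDatum.lean` no longer declares the constant while this Theorems file
— append-only, statement text fixed — still names it ("Unknown identifier" in the full builds of
2026-08-16). Re-declared here under its original fully-qualified name and definiens solely so that
the proof record keeps elaborating. TRUE (proved below). -/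
def TargetGlue : Prop :=
  ParametricKerrBurial → KerrShieldedSettles → (∀ (X : Type) [TopologicalSpace X] [ChartedSpace Literature.Geometry.Lorentzian.E3 X] [IsManifold (𝓡 3) ((⊤ : ℕ∞) : WithTop ℕ∞) X] [T2Space X] [SecondCountableTopology X] [ConnectedSpace X], ∀ D ∈ Literature.Geometry.Lorentzian.admissibleVacuumData X, ∃ 𝒟 : Literature.Geometry.Lorentzian.VacuumCauchyDevelopment D, 𝒟.IsMaximal) → UniversalWitnessFamily

end Summit.FinalStateConjecture.FinalStateConjecture.Theses.SwallowTheDatum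

namespace Summit.FinalStateConjecture.FinalStateConjecture.Theorems

open Literature.Geometry.Lorentzian

/-- The instance hypothesis `Kerr.Facts` of the Kerr–Schild prelude (connectedness of the chart
domains, analyticity of the Kerr–Schild metric section and of the time vector field) holds: all
three fields are theorems of the tree (`Kerr.isConnected_region_holds`,
`Kerr.contMDiff_bilin_holds`, `Kerr.contMDiff_timeVector_holds`). -/
theorem SwallowTheDatum.kerrFacts : Kerr.Facts :=
  ⟨Kerr.isConnected_region_holds, Kerr.contMDiff_bilin_holds, Kerr.contMDiff_timeVector_holds⟩

/-- **`TargetGlue` (route SwallowTheDatum, item stmt-FinalStateConjecture-10186).**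
`ParametricKerrBurial → KerrShieldedSettles → (∀ X, ∀ D ∈ admissibleVacuumData X, ∃ MGHD) →
UniversalWitnessFamily`: take the family `F` of the burial through the given admissible datum;
for `c ≠ 0` the `∃`-MGHD conjunct of the summit conclusion for `F c` is MGHD existence at the
admissible datum `F c`, and the `∀`-MGHD conjunct is `KerrShieldedSettles` at `F c`, whose
shielding hypothesis is exactly what the burial provides. The instance `Kerr.Facts` demanded by
the two cruxes is `SwallowTheDatum.kerrFacts`. Pure logic (the planner's `targetGlue_holds`). -/
theorem SwallowTheDatum.targetGlue_proof :
    Summit.FinalStateConjecture.FinalStateConjecture.Theses.SwallowTheDatum.TargetGlue := by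
  unfold Summit.FinalStateConjecture.FinalStateConjecture.Theses.SwallowTheDatum.TargetGlue
    Summit.FinalStateConjecture.FinalStateConjecture.Theses.SwallowTheDatum.UniversalWitnessFamily
    Summit.FinalStateConjecture.FinalStateConjecture.Theses.SwallowTheDatum.ParametricKerrBurial
    Summit.FinalStateConjecture.FinalStateConjecture.Theses.SwallowTheDatum.KerrShieldedSettles
  intro hB hS hM X _ _ _ _ _ _ d hd
  haveI : Kerr.Facts := SwallowTheDatum.kerrFacts
  obtain ⟨F, hF, h0, hinj, hadm, hshield⟩ := hB X d hd
  exact ⟨F, hF, h0, hinj, hadm, fun c hc ↦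
    ⟨hM X (F c) (hadm c), hS X (F c) (hadm c) (hshield c hc)⟩⟩

/-- **The target `UniversalWitnessFamily` (item stmt-FinalStateConjecture-10051) from the route's
cruxes**: `ParametricKerrBurial`, `KerrShieldedSettles` and `MGHDExists` (the shared MGHD
existence item stmt-FinalStateConjecture-9937, itself the named fact
`choquetBruhat_geroch_exists_mghd_cauchy` on the admissible class) imply the target — the same
glue with the route decl `MGHDExists` in place of its inlined statement. This is the reduction of
the target to the open cruxes; it closes nothing by itself. -/
theorem SwallowTheDatum.universalWitnessFamily_of_cruxes
    (hB : Summit.FinalStateConjecture.FinalStateConjecture.Theses.SwallowTheDatum.ParametricKerrBurial)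
    (hS : Summit.FinalStateConjecture.FinalStateConjecture.Theses.SwallowTheDatum.KerrShieldedSettles)
    (hM : Summit.FinalStateConjecture.FinalStateConjecture.Theses.SwallowTheDatum.MGHDExists) :
    Summit.FinalStateConjecture.FinalStateConjecture.Theses.SwallowTheDatum.UniversalWitnessFamily :=
  SwallowTheDatum.targetGlue_proof hB hS hM

end Summit.FinalStateConjecture.FinalStateConjecture.Theorems
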